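import Summits.QuantumFields.YangMills.Theorems.BalabanLadderIRcofEquipartitionSeamKernelDefs

/-!
# SUPERSEDED staging copy — the rev-8 (β) defs are LANDED

This workfile (rev 1, 511fab2419eb) was the staging copy behind idea-22 g6's LAND-ASK (bus l.1628).  It is SUPERSEDED by the landed
`Theorems/BalabanLadderIRcofEquipartitionSeamKernelDefs.lean` (p687323, LEAD ab-p1 g8, bus l.1631; crit-3 TYPEREAD ∕ GATE CLEAN l.1634), which is
the TEXT OF RECORD (rev-3 placement: `0 ≤ nrm A` in `SpectralDictOn`'s species clause; no `elPart`).  Nothing is declared here any more; import the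
landed module.  HONEST: bookkeeping; nothing located proved; `IRcof`/`IR` 0∕1; the Yang–Mills mass gap (Clay) is NOT proved by any of this.
-/
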